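import Summits.Schanuel.Schanuel.Theorems.RootDecomp1HCurveHull

/-!
# RootDecomp1H — CLEARANCE: a first failure of Schanuel's conjecture off the tower hull stands three storeys clear of
# every free tower (round 7 of route-Schanuel-RootDecomp1H; supports the declared residual `BridgeTransverse`, stmt-Schanuel-30564)

The residual `RootDecomp1H.BridgeTransverse` asks the effective gap principle at the near-`c⋆`-optimal conjugation-stable FIRST
FAILURES `y ∈ ℂⁿ` (lower ranks clean, `y` a counterexample) whose span lies in the span of NO `ℚ`-free tower tuple.  This file proves,
using ONLY those hypotheses of the item (no structural binder, no transcendence input):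

* `storey_dichotomy` (hypothesis-free): over a tower field `ℚ(b, e^b) ≥ ℚ(u, e^u)` a new number `w` either has relative depth `2`
  over `ℚ(u, e^u)` or `trdeg ℚ(b, w, e^b, e^w) ≤ N + 1` (so `(b, w)` is again a free tower, `exists_tower_extension`);
* **`clearance`**: at such a first failure, every `ℚ`-free family of `m` vectors common to `span_ℚ y` and the span of a `ℚ`-free tower
  tuple (any length) has `m + 3 ≤ n` — induction on the co-dimension; the clearance-`1` and clearance-`2` configurations are excluded by
  Schanuel in the lower ranks;
* corollaries `finrank_inf_towerSpan_add_three_le`, `clearance_rank_three` (a rank-`3` instance has NO non-zero hull element in its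
  span), `not_depthOne_of_mem_span_rank_three`, `clearance_rank_four`, and under `TowerSchanuel` (= `ProductSchanuel ∧ RelTowerSchanuel`,
  = Schanuel on 1J's curve hull `𝓚`, file `RootDecomp1HCurveHull`) `finrank_inf_curveHull_add_three_le` (`dim_ℚ(span y ∩ 𝓚) ≤ n − 3`);
* the SHARP form `BridgeSharp` of the item (its text with the tower-hull hypothesis replaced by «clearance `≥ 3` from every free tower»)
  and the EXACT re-typing `bridgeTransverse_iff_bridgeSharp : BridgeTransverse ↔ BridgeSharp` (no hypothesis).

Lens-5 cell decomp-schanuel, generation 7 (node `Clearance.lean` §14).  0 sorry; axioms standard.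
-/

set_option linter.dupNamespace false

namespace Summit.Schanuel.Schanuel.Theorems.RootDecomp1HClearance

open Complex Set
open Literature.NumberTheory.Transcendental
open Summit.Schanuel.Schanuel.Theses.RootDecomp1H
open Summit.Schanuel.Schanuel.Theorems.RootDecomp1HTowerCells
open Summit.Schanuel.Schanuel.Theorems.RootDecomp1HProductCells
open Summit.Schanuel.Schanuel.Theorems.RootDecomp1HHull
open Summit.Schanuel.Schanuel.Theorems.RootDecomp1HCurveHull

variable {n : ℕ}

/-! ## 0. The inline hypotheses of item 30564, abbreviated -/

/-- «lower ranks clean»: Schanuel's conjecture holds in every rank `< n` (inline hypothesis of `BridgeTransverse`). -/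
def LowerRanks (n : ℕ) : Prop := ∀ m < n, SchanuelRank m

/-- `y` is a COUNTEREXAMPLE of rank `n`: `ℚ`-free with `trdeg ℚ(y, e^y) < n` (inline hypothesis of `BridgeTransverse`). -/
def CounterEx (y : Fin n → ℂ) : Prop :=
  LinearIndependent ℚ y ∧ Algebra.trdeg ℚ ↥(IntermediateField.adjoin ℚ (range y ∪ range (cexp ∘ y))) < (n : Cardinal)

/-- `y` lies IN THE TOWER HULL: in the `ℚ`-span of some `ℚ`-free tower tuple (the negated inline hypothesis of `BridgeTransverse`). -/
def InTowerHull (y : Fin n → ℂ) : Prop :=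
  ∃ (N : ℕ) (b : Fin N → ℂ), LinearIndependent ℚ b ∧ TowerTuple b ∧ ∀ j, y j ∈ Submodule.span ℚ (range b)

/-! ## 1. The storey dichotomy (no hypothesis) -/

/-- Over any intermediate field, `{w, e^w}` has transcendence degree `≤ 2`. -/
theorem reltrdeg_pair_le_two (K : IntermediateField ℚ ℂ) (w : ℂ) :
    Algebra.trdeg K ↥(IntermediateField.adjoin K ({w, cexp w} : Set ℂ)) ≤ ((2 : ℕ) : Cardinal) := by
  have hsub : ({w, cexp w} : Set ℂ) ⊆ range ![w, cexp w] := by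
    rintro z (rfl | hz)
    · exact ⟨0, rfl⟩
    · rw [Set.mem_singleton_iff.1 hz]; exact ⟨1, rfl⟩
  exact (trdeg_le_of_injective (IntermediateField.inclusion (IntermediateField.adjoin.mono K _ _ hsub))
    (IntermediateField.inclusion_injective _)).trans (trdeg_adjoin_range_le (F := K) ![w, cexp w])

/-- **THE STOREY DICHOTOMY.**  `b` a tower tuple of length `N`, `u` a family inside `span_ℤ b`, `w` any number.  EITHER the new
storey `w` has relative depth `2` over `F_u = ℚ(u, e^u)` — `trdeg ℚ(u, e^u) + 2 ≤ trdeg ℚ(u, w, e^u, e^w)` — OR it has relative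
depth `≤ 1` over `L = ℚ(b, e^b) ≥ F_u`, i.e. `trdeg ℚ(b, w, e^b, e^w) ≤ N + 1`.  Tower law twice + base change `F_u ≤ L`. -/
theorem storey_dichotomy {N : ℕ} {b : Fin N → ℂ} (htow : TowerTuple b) {m : ℕ} {u : Fin m → ℂ}
    (hub : ∀ j, u j ∈ Submodule.span ℤ (range b)) (w : ℂ) :
    Algebra.trdeg ℚ ↥(IntermediateField.adjoin ℚ (range u ∪ range (cexp ∘ u))) + ((2 : ℕ) : Cardinal) ≤
        Algebra.trdeg ℚ ↥(IntermediateField.adjoin ℚ ((range u ∪ range (cexp ∘ u)) ∪ ({w, cexp w} : Set ℂ))) ∨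
      Algebra.trdeg ℚ ↥(IntermediateField.adjoin ℚ ((range b ∪ range (cexp ∘ b)) ∪ ({w, cexp w} : Set ℂ))) ≤
        ((N + 1 : ℕ) : Cardinal) := by
  set Sb : Set ℂ := range b ∪ range (cexp ∘ b) with hSb
  set Su : Set ℂ := range u ∪ range (cexp ∘ u) with hSu
  set W : Set ℂ := ({w, cexp w} : Set ℂ) with hW
  set L : IntermediateField ℚ ℂ := IntermediateField.adjoin ℚ Sb with hL
  set Fu : IntermediateField ℚ ℂ := IntermediateField.adjoin ℚ Su with hFu
  have hFuL : Fu ≤ L := adjoin_le_of_mem_span_int b u hub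
  -- tower laws and base change
  have htowL : Algebra.trdeg ℚ L + Algebra.trdeg L (IntermediateField.adjoin L W) =
      Algebra.trdeg ℚ ↥(IntermediateField.adjoin ℚ (Sb ∪ W)) := trdeg_adjoin_adjoin_eq (K := ℚ) Sb W
  have htowU : Algebra.trdeg ℚ Fu + Algebra.trdeg Fu (IntermediateField.adjoin Fu W) =
      Algebra.trdeg ℚ ↥(IntermediateField.adjoin ℚ (Su ∪ W)) := trdeg_adjoin_adjoin_eq (K := ℚ) Su W
  have hbase : Algebra.trdeg L (IntermediateField.adjoin L W) ≤ Algebra.trdeg Fu (IntermediateField.adjoin Fu W) :=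
    Literature.NumberTheory.Transcendental.trdeg_adjoin_le_of_le hFuL W
  have hrU : Algebra.trdeg Fu (IntermediateField.adjoin Fu W) ≤ ((2 : ℕ) : Cardinal) := reltrdeg_pair_le_two Fu w
  have hLN : Algebra.trdeg ℚ L ≤ (N : Cardinal) := trdeg_le_of_towerTuple htow
  have hFuN : Algebra.trdeg ℚ Fu ≤ (N : Cardinal) :=
    (trdeg_le_of_injective (IntermediateField.inclusion hFuL) (IntermediateField.inclusion_injective hFuL)).trans hLN
  -- everything is finite
  obtain ⟨tL, htL⟩ := Cardinal.lt_aleph0.mp (hLN.trans_lt Cardinal.natCast_lt_aleph0)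
  obtain ⟨tU, htU⟩ := Cardinal.lt_aleph0.mp (hFuN.trans_lt Cardinal.natCast_lt_aleph0)
  obtain ⟨rU, hrU'⟩ := Cardinal.lt_aleph0.mp (hrU.trans_lt Cardinal.natCast_lt_aleph0)
  obtain ⟨rL, hrL⟩ := Cardinal.lt_aleph0.mp ((hbase.trans hrU).trans_lt Cardinal.natCast_lt_aleph0)
  rw [htL, hrL] at htowL
  rw [htU, hrU'] at htowU
  rw [← htowL, ← htowU, htU]
  rw [htL] at hLN
  rw [hrU', hrL] at hbase
  rw [hrU'] at hrU
  norm_cast at hLN hbase hrU ⊢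
  omega


/-! ## 2. The clearance theorem -/

/-- **THE CLEARANCE THEOREM.**  At a first failure `y` of rank `n` (lower ranks clean, `y` a counterexample) OUTSIDE the tower
hull, every `ℚ`-free family `u` of `m` vectors inside `span_ℚ y ∩ span_ℚ b`, `b` any `ℚ`-free tower tuple, has `m + 3 ≤ n`. -/
theorem clearance (hlow : LowerRanks n) {y : Fin n → ℂ} (hce : CounterEx y) (hnh : ¬ InTowerHull y)
    {N : ℕ} {b : Fin N → ℂ} (hb : LinearIndependent ℚ b) (htow : TowerTuple b)
    {m : ℕ} {u : Fin m → ℂ} (hu : LinearIndependent ℚ u) (huy : ∀ j, u j ∈ Submodule.span ℚ (range y))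
    (hub : ∀ j, u j ∈ Submodule.span ℚ (range b)) : m + 3 ≤ n := by
  classical
  -- induction on the co-dimension `k = n - m`
  suffices h : ∀ (k m : ℕ), m + k = n → ∀ (N : ℕ) (b : Fin N → ℂ), LinearIndependent ℚ b → TowerTuple b →
      ∀ (u : Fin m → ℂ), LinearIndependent ℚ u → (∀ j, u j ∈ Submodule.span ℚ (range y)) →
        (∀ j, u j ∈ Submodule.span ℚ (range b)) → m + 3 ≤ n by
    have hmn : m ≤ n := by
      haveI := FiniteDimensional.span_of_finite ℚ (Set.finite_range y)
      have h1 := finrank_span_eq_card hu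
      have h2 := finrank_span_eq_card hce.1
      have h3 := Submodule.finrank_mono (Submodule.span_le.2 (Set.range_subset_iff.2 huy))
      simp only [Fintype.card_fin] at h1 h2
      omega
    exact h (n - m) m (by omega) N b hb htow u hu huy hub
  intro k
  induction k with
  | zero =>
    -- `m = n`: `span u = span y ≤ span b`, so `y` is in the hull
    intro m hm N b hb htow u hu huy hub
    obtain rfl : m = n := by omega
    exfalso
    haveI := FiniteDimensional.span_of_finite ℚ (Set.finite_range y)
    haveI := FiniteDimensional.span_of_finite ℚ (Set.finite_range u)
    have hle : Submodule.span ℚ (range u) ≤ Submodule.span ℚ (range y) :=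
      Submodule.span_le.2 (Set.range_subset_iff.2 huy)
    have heq : Submodule.span ℚ (range u) = Submodule.span ℚ (range y) :=
      Submodule.eq_of_le_of_finrank_eq hle ((finrank_span_eq_card hu).trans (finrank_span_eq_card hce.1).symm)
    refine hnh ⟨N, b, hb, htow, fun j => ?_⟩
    have hj : y j ∈ Submodule.span ℚ (range u) := heq ▸ Submodule.subset_span ⟨j, rfl⟩
    exact (Submodule.span_le.2 (Set.range_subset_iff.2 hub)) hj
  | succ k ih =>
    intro m hm N b hb htow u hu huy hub
    have hmn : m < n := by omega
    haveI := FiniteDimensional.span_of_finite ℚ (Set.finite_range y)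
    haveI := FiniteDimensional.span_of_finite ℚ (Set.finite_range u)
    -- a coordinate of `y` outside `span u`
    have hex : ∃ j₀, y j₀ ∉ Submodule.span ℚ (range u) := by
      by_contra hall
      push Not at hall
      have hle : Submodule.span ℚ (range y) ≤ Submodule.span ℚ (range u) :=
        Submodule.span_le.2 (by rintro _ ⟨j, rfl⟩; exact hall j)
      have h1 := finrank_span_eq_card hce.1
      have h2 := finrank_span_eq_card hu
      have h3 := Submodule.finrank_mono hle
      simp only [Fintype.card_fin] at h1 h2
      omega
    obtain ⟨j₀, hj₀⟩ := hex
    set w : ℂ := y j₀ with hw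
    -- scale `u` into `span_ℤ y ∩ span_ℤ b`
    choose N₁ hN₁ hN₁_mem using fun i => Literature.NumberTheory.Transcendental.exists_nsmul_mem_span_int y (huy i)
    choose N₂ hN₂ hN₂_mem using fun i => Literature.NumberTheory.Transcendental.exists_nsmul_mem_span_int b (hub i)
    let q : Fin m → ℚ := fun i => ((N₁ i * N₂ i : ℕ) : ℚ)
    have hq : ∀ i, q i ≠ 0 := fun i => Nat.cast_ne_zero.2 (mul_ne_zero (hN₁ i) (hN₂ i))
    let u' : Fin m → ℂ := fun i => q i • u i
    have hu'li : LinearIndependent ℚ u' := linearIndependent_smul hu q hq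
    have hspan : Submodule.span ℚ (range u') = Submodule.span ℚ (range u) := span_range_smul_eq u q hq
    have hu'_memy : ∀ i, u' i ∈ Submodule.span ℤ (range y) := by
      intro i
      have h : u' i = (N₂ i : ℚ) • ((N₁ i : ℚ) • u i) := by
        show ((N₁ i * N₂ i : ℕ) : ℚ) • u i = _
        rw [smul_smul, Nat.cast_mul, mul_comm]
      rw [h, Nat.cast_smul_eq_nsmul]
      exact nsmul_mem (hN₁_mem i) (N₂ i)
    have hu'_memb : ∀ i, u' i ∈ Submodule.span ℤ (range b) := by
      intro i
      have h : u' i = (N₁ i : ℚ) • ((N₂ i : ℚ) • u i) := by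
        show ((N₁ i * N₂ i : ℕ) : ℚ) • u i = _
        rw [smul_smul, Nat.cast_mul]
      rw [h, Nat.cast_smul_eq_nsmul]
      exact nsmul_mem (hN₂_mem i) (N₁ i)
    have hu'y : ∀ i, u' i ∈ Submodule.span ℚ (range y) := fun i => Submodule.smul_mem _ _ (huy i)
    have hu'b : ∀ i, u' i ∈ Submodule.span ℚ (range b) := fun i => Submodule.smul_mem _ _ (hub i)
    -- the dichotomy at the storey `w`
    rcases storey_dichotomy htow hu'_memb w with hdeep | hshallow
    · -- relative depth 2: `m + 2 ≤ trdeg F_u' + 2 ≤ trdeg ℚ(u', w, …) ≤ trdeg ℚ(y, e^y) < n`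
      have hm : (m : Cardinal) ≤ Algebra.trdeg ℚ ↥(IntermediateField.adjoin ℚ (range u' ∪ range (cexp ∘ u'))) :=
        hlow m hmn u' hu'li
      have hle : IntermediateField.adjoin ℚ ((range u' ∪ range (cexp ∘ u')) ∪ ({w, cexp w} : Set ℂ)) ≤
          IntermediateField.adjoin ℚ (range y ∪ range (cexp ∘ y)) := by
        rw [IntermediateField.adjoin_le_iff]
        rintro a ((⟨i, rfl⟩ | ⟨i, rfl⟩) | rfl | ha)
        · exact (Literature.NumberTheory.Transcendental.mem_adjoin_of_mem_span_int y (hu'_memy i)).1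
        · exact (Literature.NumberTheory.Transcendental.mem_adjoin_of_mem_span_int y (hu'_memy i)).2
        · exact IntermediateField.subset_adjoin ℚ _ (Or.inl ⟨j₀, rfl⟩)
        · rw [Set.mem_singleton_iff.1 ha]
          exact IntermediateField.subset_adjoin ℚ _ (Or.inr ⟨j₀, rfl⟩)
      have hQY := trdeg_le_of_injective (IntermediateField.inclusion hle) (IntermediateField.inclusion_injective hle)
      have hchain : (m : Cardinal) + ((2 : ℕ) : Cardinal) < (n : Cardinal) :=
        ((add_le_add hm le_rfl).trans (hdeep.trans hQY)).trans_lt hce.2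
      norm_cast at hchain
    · -- relative depth ≤ 1: `(b, w)` extends to a free tower `c` with `span b ≤ span c ∋ w`; induct with `(u', w)`
      obtain ⟨L, c, hc, hctow, hbc, hwc⟩ := exists_tower_extension hb htow hshallow
      have hw' : w ∉ Submodule.span ℚ (range u') := hspan ▸ hj₀
      have hli : LinearIndependent ℚ (Fin.snoc u' w : Fin (m + 1) → ℂ) := linearIndependent_finSnoc.2 ⟨hu'li, hw'⟩
      have hmemy : ∀ j, (Fin.snoc u' w : Fin (m + 1) → ℂ) j ∈ Submodule.span ℚ (range y) := by
        intro j
        refine Fin.lastCases ?_ (fun i => ?_) j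
        · rw [Fin.snoc_last]; exact Submodule.subset_span ⟨j₀, rfl⟩
        · rw [Fin.snoc_castSucc]; exact hu'y i
      have hmemc : ∀ j, (Fin.snoc u' w : Fin (m + 1) → ℂ) j ∈ Submodule.span ℚ (range c) := by
        intro j
        refine Fin.lastCases ?_ (fun i => ?_) j
        · rw [Fin.snoc_last]; exact hwc
        · rw [Fin.snoc_castSucc]; exact hbc (hu'b i)
      have h := ih (m + 1) (by omega) L c hc hctow (Fin.snoc u' w) hli hmemy hmemc
      omega

/-- **CLEARANCE, finrank form**: `finrank_ℚ (span_ℚ y ⊓ span_ℚ b) + 3 ≤ n` for every `ℚ`-free tower tuple `b`. -/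
theorem finrank_inf_towerSpan_add_three_le (hlow : LowerRanks n) {y : Fin n → ℂ} (hce : CounterEx y)
    (hnh : ¬ InTowerHull y) {N : ℕ} {b : Fin N → ℂ} (hb : LinearIndependent ℚ b) (htow : TowerTuple b) :
    Module.finrank ℚ ↥(Submodule.span ℚ (range y) ⊓ Submodule.span ℚ (range b)) + 3 ≤ n := by
  classical
  haveI := FiniteDimensional.span_of_finite ℚ (Set.finite_range y)
  set U : Submodule ℚ ℂ := Submodule.span ℚ (range y) ⊓ Submodule.span ℚ (range b) with hU
  haveI : FiniteDimensional ℚ ↥U := Submodule.finiteDimensional_of_le inf_le_left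
  let bU := Module.finBasis ℚ ↥U
  let u : Fin (Module.finrank ℚ ↥U) → ℂ := fun i => (bU i : ℂ)
  have hu : LinearIndependent ℚ u := bU.linearIndependent.map' U.subtype (Submodule.ker_subtype U)
  have hmem : ∀ i, u i ∈ U := fun i => (bU i).2
  exact clearance hlow hce hnh hb htow hu (fun i => (Submodule.mem_inf.1 (hmem i)).1)
    fun i => (Submodule.mem_inf.1 (hmem i)).2

/-- **RANK THREE: FULL CLEARANCE.**  The span of a rank-`≤ 3` first failure outside the hull contains NO non-zero hull element. -/
theorem clearance_rank_three (hn : n ≤ 3) (hlow : LowerRanks n) {y : Fin n → ℂ} (hce : CounterEx y)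
    (hnh : ¬ InTowerHull y) {t : ℂ} (hty : t ∈ Submodule.span ℚ (range y)) (ht : t ∈ towerHullSet) : t = 0 := by
  by_contra h0
  obtain ⟨N, b, hb, htow, htb⟩ := ht
  have hu : LinearIndependent ℚ (fun _ : Fin 1 => t) := (linearIndependent_unique_iff (v := fun _ : Fin 1 => t)).2 h0
  have h := clearance hlow hce hnh hb htow hu (fun _ => hty) fun _ => htb
  omega

/-- … in particular no element of depth `≤ 1` (algebraic numbers, logarithms of algebraic numbers, zeros of `P(z, e^z)`):
every non-zero `z` in the span has `trdeg ℚ(z, e^z) = 2`. -/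
theorem not_depthOne_of_mem_span_rank_three (hn : n ≤ 3) (hlow : LowerRanks n) {y : Fin n → ℂ} (hce : CounterEx y)
    (hnh : ¬ InTowerHull y) {z : ℂ} (hzy : z ∈ Submodule.span ℚ (range y)) (hz : z ≠ 0) :
    ¬ Algebra.trdeg ℚ ↥(IntermediateField.adjoin ℚ ({z, cexp z} : Set ℂ)) ≤ 1 :=
  fun hd => hz (clearance_rank_three hn hlow hce hnh hzy (mem_towerHullSet_of_depthOne hd))

/-- RANK FOUR: at most a LINE of hull elements — two `ℚ`-independent elements of `span_ℚ y ∩ span_ℚ b` are impossible. -/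
theorem clearance_rank_four (hn : n ≤ 4) (hlow : LowerRanks n) {y : Fin n → ℂ} (hce : CounterEx y)
    (hnh : ¬ InTowerHull y) {N : ℕ} {b : Fin N → ℂ} (hb : LinearIndependent ℚ b) (htow : TowerTuple b)
    {u : Fin 2 → ℂ} (hu : LinearIndependent ℚ u) (huy : ∀ j, u j ∈ Submodule.span ℚ (range y))
    (hub : ∀ j, u j ∈ Submodule.span ℚ (range b)) : False := by
  have h := clearance hlow hce hnh hb htow hu huy hub
  omega


/-! ## 3. Under the structural binders: clearance from 1J's curve hull `𝓚` -/

/-- **CLEARANCE FROM THE CURVE HULL** (under `TowerSchanuel`, where `𝒯̂ = 𝓚` is a `ℚ`-subspace): `finrank_ℚ (span_ℚ y ⊓ 𝓚) + 3 ≤ n`. -/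
theorem finrank_inf_curveHull_add_three_le (hTS : TowerSchanuel) (hlow : LowerRanks n) {y : Fin n → ℂ}
    (hce : CounterEx y) (hnh : ¬ InTowerHull y) :
    Module.finrank ℚ ↥(Submodule.span ℚ (range y) ⊓ curveHull) + 3 ≤ n := by
  classical
  haveI := FiniteDimensional.span_of_finite ℚ (Set.finite_range y)
  set U : Submodule ℚ ℂ := Submodule.span ℚ (range y) ⊓ curveHull with hU
  haveI : FiniteDimensional ℚ ↥U := Submodule.finiteDimensional_of_le inf_le_left
  let bU := Module.finBasis ℚ ↥U
  let u : Fin (Module.finrank ℚ ↥U) → ℂ := fun i => (bU i : ℂ)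
  have hu : LinearIndependent ℚ u := bU.linearIndependent.map' U.subtype (Submodule.ker_subtype U)
  have hmem : ∀ i, u i ∈ U := fun i => (bU i).2
  have huK : ∀ i, u i ∈ towerHullSet := by
    intro i
    rw [towerHullSet_eq_curveHull hTS]
    exact (Submodule.mem_inf.1 (hmem i)).2
  obtain ⟨N, b, hb, htow, hsub⟩ := exists_tower_of_finset hTS (Finset.univ.image u) (by
    intro z hz
    obtain ⟨i, -, rfl⟩ := Finset.mem_image.mp (Finset.mem_coe.mp hz)
    exact huK i)
  exact clearance hlow hce hnh hb htow hu (fun i => (Submodule.mem_inf.1 (hmem i)).1) fun i =>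
    hsub (Finset.mem_coe.mpr (Finset.mem_image_of_mem u (Finset.mem_univ i)))

/-- The same under the route's two structural binders `ProductSchanuel` (28261) and `RelTowerSchanuel` (28933). -/
theorem finrank_inf_curveHull_add_three_le' (hPS : ProductSchanuel) (hRT : RelTowerSchanuel) (hlow : LowerRanks n)
    {y : Fin n → ℂ} (hce : CounterEx y) (hnh : ¬ InTowerHull y) :
    Module.finrank ℚ ↥(Submodule.span ℚ (range y) ⊓ curveHull) + 3 ≤ n :=
  finrank_inf_curveHull_add_three_le (towerSchanuel_of_structural hPS hRT) hlow hce hnh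

/-! ## 4. The SHARP form of the residual and the exact re-typing -/

/-- `y` is SHARP: its span stands three storeys clear of every free tower span. -/
def Sharp (y : Fin n → ℂ) : Prop :=
  ∀ (N : ℕ) (b : Fin N → ℂ), LinearIndependent ℚ b → TowerTuple b →
    ∀ (m : ℕ) (u : Fin m → ℂ), LinearIndependent ℚ u → (∀ j, u j ∈ Submodule.span ℚ (range y)) →
      (∀ j, u j ∈ Submodule.span ℚ (range b)) → m + 3 ≤ n

/-- A first failure outside the hull is sharp (the clearance theorem) … -/
theorem sharp_of_not_inTowerHull (hlow : LowerRanks n) {y : Fin n → ℂ} (hce : CounterEx y) (hnh : ¬ InTowerHull y) :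
    Sharp y :=
  fun _ _ hb htow _ _ hu huy hub => clearance hlow hce hnh hb htow hu huy hub

/-- … and a sharp `ℚ`-free tuple is outside the hull (no hypothesis). -/
theorem not_inTowerHull_of_sharp {y : Fin n → ℂ} (hy : LinearIndependent ℚ y) (h : Sharp y) : ¬ InTowerHull y := by
  rintro ⟨N, b, hb, htow, hmem⟩
  have h' := h N b hb htow n y hy (fun j => Submodule.subset_span ⟨j, rfl⟩) hmem
  omega

/-- **P-BRIDGE⋆-SHARP**: the text of `RootDecomp1H.BridgeTransverse` (stmt-Schanuel-30564) with its tower-hull hypothesis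
`¬ ∃ N b, …` replaced by the CLEARANCE clause «`span_ℚ y` meets the span of every `ℚ`-free tower tuple in codimension `≥ 3`». -/
def BridgeSharp : Prop :=
  ∀ (n c : ℕ), (∀ m < n, Literature.NumberTheory.Transcendental.SchanuelRank m) → ∀ y : Fin n → ℂ, (((∃ g : Fin n → MvPolynomial (Fin n ⊕ Fin n) ℚ, (∀ i, max (g i).totalDegree ((g i).support.sup fun m => max ((g i).coeff m).num.natAbs ((g i).coeff m).den) ≤ c) ∧ (∀ i, MvPolynomial.aeval (Sum.elim y (Complex.exp ∘ y)) (g i) = 0) ∧ (Matrix.of fun i j => MvPolynomial.aeval (Sum.elim y (Complex.exp ∘ y)) (Literature.NumberTheory.Transcendental.Khovanskii.ePD j (g i))).det ≠ 0) ∧ ‖y‖ ≤ ((4 ^ c : ℕ) : ℝ)) ∧ ∀ c' < c, ¬ (∃ y' : Fin n → ℂ, Submodule.span ℚ (Set.range y) = Submodule.span ℚ (Set.range y') ∧ (∃ g' : Fin n → MvPolynomial (Fin n ⊕ Fin n) ℚ, (∀ i, max (g' i).totalDegree ((g' i).support.sup fun m => max ((g' i).coeff m).num.natAbs ((g' i).coeff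 m).den) ≤ c') ∧ (∀ i, MvPolynomial.aeval (Sum.elim y' (Complex.exp ∘ y')) (g' i) = 0) ∧ (Matrix.of fun i j => MvPolynomial.aeval (Sum.elim y' (Complex.exp ∘ y')) (Literature.NumberTheory.Transcendental.Khovanskii.ePD j (g' i))).det ≠ 0) ∧ ‖y'‖ ≤ ((4 ^ c' : ℕ) : ℝ))) → (∀ j, (starRingEnd ℂ) (y j) ∈ Submodule.span ℚ (Set.range y)) → (LinearIndependent ℚ y ∧ Algebra.trdeg ℚ ↥(IntermediateField.adjoin ℚ (Set.range y ∪ Set.range (Complex.exp ∘ y))) < (n : Cardinal)) → (∀ (N : ℕ) (b : Fin N → ℂ), LinearIndependent ℚ b → (∀ (k : ℕ) (hk : k ≤ N), Algebra.trdeg ℚ ↥(IntermediateField.adjoin ℚ (Set.range (b ∘ Fin.castLE hk) ∪ Set.range (Complex.exp ∘ (b ∘ Fin.castLE hk)))) ≤ (k : Cardinal)) → ∀ (m : ℕ) (u : Fin m → ℂ), LinearIndependent ℚ u → (∀ j, u j ∈ Submodule.span ℚ (Set.range y)) → (∀ j, u j ∈ Submodule.span ℚ (Set.range b)) → m + 3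 ≤ n) → (∃ P : Fin (n + 1) → MvPolynomial (Fin n ⊕ Fin n) ℤ, (∀ i, max (P i).totalDegree ((P i).support.sup fun m => ((P i).coeff m).natAbs) ≤ c + 3) ∧ (∀ i, MvPolynomial.aeval (Sum.elim y (Complex.exp ∘ y)) (P i) = 0) ∧ LinearIndependent ℂ (fun i => fun s : Fin n ⊕ Fin n => MvPolynomial.aeval (Sum.elim y (Complex.exp ∘ y)) (MvPolynomial.pderiv s (P i))))

/-- **EXACT RE-TYPING (no hypothesis)**: the live residual and its sharp form are equivalent — the clearance-`1` and
clearance-`2` cells were never first failures, by the lower-rank hypothesis the item itself carries. -/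
theorem bridgeTransverse_iff_bridgeSharp : BridgeTransverse ↔ BridgeSharp :=
  ⟨fun h n c hlow y hopt hcs hce hsh => h n c hlow y hopt hcs hce
      (not_inTowerHull_of_sharp (n := n) hce.1 hsh),
    fun h n c hlow y hopt hcs hce hnh => h n c hlow y hopt hcs hce
      (sharp_of_not_inTowerHull (n := n) hlow hce hnh)⟩

/-- `Schanuel` implies the sharp form (exactness of the route is preserved). -/
theorem bridgeSharp_of_schanuel (h : _root_.Schanuel) : BridgeSharp :=
  bridgeTransverse_iff_bridgeSharp.1 fun n _ _ y _ _ hce _ => absurd (h n y hce.1) (not_le.2 hce.2)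

/-- In ranks `≤ 2` a counterexample is ITSELF a tower tuple (its field has transcendence degree `≤ n - 1 ≤ k` over every
prefix of length `k ≥ 1`, and `0` over the empty prefix). -/
theorem towerTuple_of_counterEx_rank_le_two (hn : n ≤ 2) {y : Fin n → ℂ} (hce : CounterEx y) : TowerTuple y := by
  intro k hk
  by_cases hk0 : k = 0
  · subst hk0
    exact trdeg_le_of_depthOne _ fun j => Fin.elim0 j
  · have hsub : range (y ∘ Fin.castLE hk) ∪ range (cexp ∘ (y ∘ Fin.castLE hk)) ⊆ range y ∪ range (cexp ∘ y) := by
      rintro z (⟨i, rfl⟩ | ⟨i, rfl⟩)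
      · exact Or.inl ⟨_, rfl⟩
      · exact Or.inr ⟨_, rfl⟩
    have hmono := trdeg_le_of_injective (IntermediateField.inclusion (IntermediateField.adjoin.mono ℚ _ _ hsub))
      (IntermediateField.inclusion_injective _)
    have hlt := hmono.trans_lt hce.2
    obtain ⟨t, ht⟩ := Cardinal.lt_aleph0.mp (hlt.trans (Cardinal.natCast_lt_aleph0 (n := n)))
    have htn : (t : Cardinal) < (n : Cardinal) := ht ▸ hlt
    have htk : t ≤ k := by
      norm_cast at htn
      omega
    exact ht.le.trans (by exact_mod_cast htk)

/-- **THE FLOOR (ranks `≤ 2`)**: no rank-`≤ 2` counterexample is sharp — it lies in the hull through itself.  Hence the sharp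
form, like the residual, has no instance below rank `3`. -/
theorem not_sharp_of_counterEx_rank_le_two (hn : n ≤ 2) {y : Fin n → ℂ} (hce : CounterEx y) : ¬ Sharp y :=
  fun hsh => not_inTowerHull_of_sharp hce.1 hsh
    ⟨n, y, hce.1, towerTuple_of_counterEx_rank_le_two hn hce, fun j => Submodule.subset_span ⟨j, rfl⟩⟩

end Summit.Schanuel.Schanuel.Theorems.RootDecomp1HClearance
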